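import Mathlib
import HarnessLib
import Summits.RiemannHypothesis.RiemannHypothesis.Theorems.IntegerScrewRungCertFused

/-!
# Route `IntegerScrew` — kernel certificate checker: the fused column-charge test with VARIABLE chunk sizes (re-land `…FusedS`)

The FUSED column-charge domination test of `IntegerScrewRungCertFused` decides the rows in chunks of a CONSTANT size `c`
(`zrowW_of_fusedD`).  At `N = 511` the kernel cost of a row grows from `< 0.1 s` (row 0) to `≈ 9 s` (row 510) while one
`decide +kernel` is capped (allocation) at roughly 30 s of work (screw-kernel-2 g0, farm measurements 2026-08-26: rows 100–109 in 9 s, 300–303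
in 14 s, 508–510 in 26 s), so a constant size is either unsafe at the bottom or wasteful at the top.  This module is a byte-for-byte RE-LAND of `IntegerScrewRungCertFusedB` (p419819, accepted 2026-08-26T03:31Z) under fresh names (suffix `S`), filed because the hub
olean of `…FusedB` was never built (post-accept build enqueue lost across a gate restart; the same happened to `…Rung512DataA2`).  It lets chunk `k` have
its own size `szs[k]` (start `chunkStartS szs k = szs[0] + … + szs[k−1]`, sizes summing to `N`), with the SAME chunk function
`fusedChunkKPD`, and a final test on the concatenated creditsS:
* `chunkStartS`, `creditsS` (concatenation of the chunks' credit lists), **`fusedFinalS N outs`** (column-charge totals ≤ creditsS, one pass);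
* `creditsS_getD`, `sum_chunks_sizesS` (re-indexing a sum over consecutive chunks of the given sizes), ★ **`zrowW_of_fusedS`**: sizes summing
  to `N`, the chunk equations `fusedChunkKPD … (chunkStartS szs k) (szs[k]) = outs[k]` and `fusedFinalS N outs = true` ⇒ every indexed row test
  `zrowW N utab Lz lamZ i` — consumed unchanged by `posDef_of_pieces` / `posDef_of_rungW_mem`.
Nothing here bears on the truth of RH.  Refs: Rump, Acta Numerica 19 (2010) §10.8 [folklore]; [Suzuki2023].
-/
set_option linter.dupNamespace false
set_option autoImplicit false
namespace Summit.RiemannHypothesis.RiemannHypothesis.Theorems.IntegerScrew.RungCert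

open Literature.NumberTheory.LFunctions Literature.Analysis.ValidatedNumerics Finset
open Literature.Analysis.ValidatedNumerics.Numerics Literature.Analysis.ValidatedNumerics.KroneckerDot
open scoped BigOperators

/-! ## Variable chunk sizes -/

/-- Start row of chunk `k` for the size list `szs`: `szs[0] + … + szs[k−1]`. [folklore] -/
def chunkStartS (szs : List ℕ) (k : ℕ) : ℕ := (szs.take k).sum

/-- The chunks' credit lists concatenated (= the creditsS of rows `0, 1, …` in order). [folklore] -/
def creditsS : List (List ℤ × List ℤ) → List ℤ
  | [] => []
  | o :: os => o.1 ++ creditsS os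

/-- **The final (light) test, variable sizes**: for every `m < N`, the total column charge at `m` is at most the credit of row `m`. [folklore] -/
def fusedFinalS (N : ℕ) (outs : List (List ℤ × List ℤ)) : Bool :=
  let S := colSums outs
  let D := creditsS outs
  rall N fun m => decide (S.getD m 0 ≤ D.getD m 0)

/-- `chunkStartS` on a cons. [folklore] -/
theorem chunkStartS_cons_succ (c : ℕ) (szs : List ℕ) (k : ℕ) : chunkStartS (c :: szs) (k + 1) = c + chunkStartS szs k := by
  simp [chunkStartS, List.take_succ_cons, List.sum_cons]

/-- `chunkStartS _ 0 = 0`. [folklore] -/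
theorem chunkStartS_zero (szs : List ℕ) : chunkStartS szs 0 = 0 := by simp [chunkStartS]

/-- A chunk ends inside the total. [folklore] -/
theorem chunkStartS_add_le : ∀ (szs : List ℕ) (k : ℕ), k < szs.length → chunkStartS szs k + szs.getD k 0 ≤ szs.sum
  | [], k, hk => by simp at hk
  | c :: szs, 0, _ => by simp [chunkStartS]
  | c :: szs, k + 1, hk => by
      rw [chunkStartS_cons_succ, List.getD_cons_succ, List.sum_cons, add_assoc]
      exact Nat.add_le_add_left (chunkStartS_add_le szs k (by simpa using hk)) c

/-- Entries of the concatenated creditsS, when chunk `k` contributes the values `f (chunkStartS k + t)`, `t < szs[k]`. [folklore] -/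
theorem creditsS_getD (f : ℕ → ℤ) : ∀ (szs : List ℕ) (outs : List (List ℤ × List ℤ)) (s : ℕ), outs.length = szs.length →
    (∀ k < szs.length, (outs.getD k ([], [])).1 = (List.range (szs.getD k 0)).map (fun t => f (s + chunkStartS szs k + t))) →
    ∀ i < szs.sum, (creditsS outs).getD i 0 = f (s + i)
  | [], outs, s, _, _, i, hi => by simp at hi
  | c :: szs, [], s, hlen, _, i, hi => by simp at hlen
  | c :: szs, o :: outs, s, hlen, hch, i, hi => by
      have h0 := hch 0 (by simp)
      simp only [List.getD_cons_zero, chunkStartS_zero, add_zero] at h0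
      have hlen' : outs.length = szs.length := by simpa using hlen
      have hch' : ∀ k < szs.length, (outs.getD k ([], [])).1 =
          (List.range (szs.getD k 0)).map (fun t => f ((s + c) + chunkStartS szs k + t)) := by
        intro k hk
        have := hch (k + 1) (by simpa using Nat.succ_lt_succ hk)
        rw [List.getD_cons_succ, List.getD_cons_succ, chunkStartS_cons_succ] at this
        rw [this]
        refine List.map_congr_left fun t _ => ?_
        congr 1; omega
      rw [creditsS, h0, List.getD_eq_getElem?_getD]
      rcases lt_or_ge i c with hic | hic
      · rw [List.getElem?_append_left (by simpa using hic), List.getElem?_map, List.getElem?_range hic]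
        simp
      · rw [List.sum_cons] at hi
        rw [List.getElem?_append_right (by simpa using hic), List.length_map, List.length_range,
          ← List.getD_eq_getElem?_getD, creditsS_getD f szs outs (s + c) hlen' hch' (i - c) (by omega)]
        congr 1; omega

/-- Re-indexing a sum over consecutive chunks of sizes `szs`: `Σ_k Σ_{t<szs[k]} g(start_k + t) = Σ_{j < Σ szs} g j`. [folklore] -/
theorem sum_chunks_sizesS (g : ℕ → ℤ) : ∀ (szs : List ℕ),
    ∑ k ∈ range szs.length, ∑ t ∈ range (szs.getD k 0), g (chunkStartS szs k + t) = ∑ j ∈ range szs.sum, g j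
  | [] => by simp
  | c :: szs => by
      rw [List.length_cons, Finset.sum_range_succ', List.sum_cons, Finset.sum_range_add]
      simp only [List.getD_cons_zero, chunkStartS_zero, zero_add, List.getD_cons_succ, chunkStartS_cons_succ]
      rw [add_comm]
      congr 1
      have := sum_chunks_sizesS (fun j => g (c + j)) szs
      simpa [add_assoc] using this

/-! ## Soundness -/
section specB
variable {N : ℕ} {utab : List (List FI)} {lamZ : ℤ} {W Mx : ℕ}

/-- ★ **FUSED chunks of variable sizes decide every row**: sizes `szs` summing to `N`, each chunk's output equal to `outs[k]`
(chunk `k` = rows `chunkStartS szs k ≤ i < chunkStartS szs k + szs[k]`, first column supplied as a literal `D = dcol utab`), and the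
light final test passed ⇒ every indexed row test holds (for `Lz = unpackRowsZ B O lzP 0`). [folklore] -/
theorem zrowW_of_fusedS {B O : ℕ} {szs : List ℕ} {lzP : List ℕ} {outs : List (List ℤ × List ℤ)} {D : List FI}
    (hlen : utab.length = N + 2) (hN : 1 ≤ N) (hsz : szs.sum = N)
    (hlz : lzOK (RungCert.unpackRowsZ B O lzP 0) N = true)
    (hab : absBoundOK Mx (RungCert.unpackRowsZ B O lzP 0) = true) (hcap : N * Mx * Mx < W)
    (hLz : lzP.length = N) (houts : outs.length = szs.length) (hD : D = dcol utab)
    (hch : ∀ k < szs.length,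
      fusedChunkKPD N utab D lzP lamZ B O W (chunkStartS szs k) (szs.getD k 0) = outs.getD k ([], []))
    (hfin : fusedFinalS N outs = true) :
    ∀ i < N, zrowW N utab (RungCert.unpackRowsZ B O lzP 0) lamZ i = true := by
  subst hD
  set Lz := RungCert.unpackRowsZ B O lzP 0 with hLzdef
  have hLzlen : Lz.length = N := by rw [hLzdef, length_unpackRowsZ, hLz]
  -- the spec of every chunk
  have hspec : ∀ k < szs.length,
      (outs.getD k ([], [])).1 = (List.range (szs.getD k 0)).map (fun t => creditZ N utab Lz lamZ (chunkStartS szs k + t)) ∧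
      ∀ m, (outs.getD k ([], [])).2.getD m 0 =
        ∑ t ∈ range (szs.getD k 0), (if m < chunkStartS szs k + t then chargeZ N utab Lz lamZ (chunkStartS szs k + t) m else 0) := by
    intro k hk
    rw [← hch k hk]
    unfold fusedChunkKPD
    rw [ksPacked_eq lzP 0 (by simp [hLz])]
    have hkc : chunkStartS szs k + szs.getD k 0 ≤ N := hsz ▸ chunkStartS_add_le szs k hk
    obtain ⟨k1, _, k3⟩ := fRows_spec (lamZ := lamZ) hlen hN hlz hab hcap hLzlen (szs.getD k 0) (chunkStartS szs k)
      (List.replicate N 0) [] hkc (by simp)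
    refine ⟨by simpa using k1, fun m => ?_⟩
    rw [k3 m]
    simp
  intro i hi
  -- credit of `i` from the concatenation
  have hcred : (creditsS outs).getD i 0 = creditZ N utab Lz lamZ i := by
    have := creditsS_getD (creditZ N utab Lz lamZ) szs outs 0 houts
      (fun k hk => by simpa using (hspec k hk).1) i (by omega)
    simpa using this
  -- the column charges at `i` summed over chunks = Σ_{j > i} charge_j(i)
  have hsum : sumP outs i = ∑ j ∈ range N, (if i < j then chargeZ N utab Lz lamZ j i else 0) := by
    unfold sumP
    rw [sum_map_eq_sum_range_getD _ ([], []), houts]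
    rw [Finset.sum_congr rfl (fun k hk => (hspec k (mem_range.1 hk)).2 i)]
    rw [sum_chunks_sizesS (fun j => if i < j then chargeZ N utab Lz lamZ j i else 0) szs, hsz]
  -- the final test at `i`
  have hfin' : sumP outs i ≤ (creditsS outs).getD i 0 := by
    simp only [fusedFinalS] at hfin
    have := of_rall hfin (k := i) hi
    rw [← getD_colSums]
    simpa using this
  rw [hcred, hsum] at hfin'
  exact zrowW_of_credit hlen hi hfin'

end specB

end Summit.RiemannHypothesis.RiemannHypothesis.Theorems.IntegerScrew.RungCert
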